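import Mathlib
import Literature.Computability.Complexity.CanonicalCodes
import Literature.Computability.Complexity.CodeFPArith
import Literature.Computability.Complexity.Nondeterministic
import Literature.Computability.Complexity.LengthCompare

/-!
# Certificates and the untyped verifier of the residual language (line `kotzig-cutspan`, stub `stub_residueNP`)

Crux `Summit.PneNP.PneNP.Theses.SymmetryBudget.HamCompiles` (stmt-PneNP-10637), line
`kotzig-cutspan`, stub `stub_residueNP` (`ResidueLang ∈ NP`); first auxiliary file, independent of
the line's definitions (registered sub-goal `stub_residueNP_decode`).

* UNTYPED certificates `(m, d, PA, s₀)` (numbers, lists of numbers, lists of labelled vertex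
  lists), their code `certE` (the tree's `boolPair` / `Encoding.listBool` / `encodeNat` codes), a
  TOTAL decoder `decCert` computed on codes in polynomial time by the canonicalisation bricks of
  `CanonicalCodes.lean` (`decCert_codeFP : CodeFP strE certE decCert`, `decCert_certE`), and the
  generic assembly `mem_NP_of_check`: a language is in `NP = polyExists P` as soon as a Boolean
  test `check : string × certificate → Bool` computed on codes in polynomial time (`CodeFP`) is
  sound, and complete with polynomially short certificates.
* The verifier `ResNP.check` as an explicit functional program on untyped data, in the exact shape
  in which the combinators of `CodeFP*.lean` compute it (`…StubResidueNPCode.lean`) and in which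
  it is compared with the residual predicate `Residue` (`…StubResidueNPSpec.lean`): the interface
  string `s` is read at the positions of the explicit layout `iIdxEquiv` of the line (`abit`,
  `nbit`, `fbit`); the certificate is checked by `hdrOK` (`4 ≤ m`, `|s| = ell m`), `dOK`
  (`|d| = g`, `Σ d ≤ 2g`), `shapeOK`, `coverOK` / `chainsOK` / `labelsOK` / `slotsOK` (the labelled
  path cover of the anchored block) and `parityOK` (an odd number of admissible consistent cuts
  `S < 2^g` read in the F-block at row `s₀` of the stars-and-bars code word `sbNum` of `d`).

References: S. Arora, B. Barak, *Computational Complexity: A Modern Approach*, CUP 2009, Def. 2.1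
(`NP` by certificates), §0.1 (codes of tuples and lists), §1.3 (closure properties of polynomial
time).
-/

-- `Summit.PneNP.PneNP.…` duplicates `PneNP` BY DESIGN (single-problem summit, D-0017).
set_option linter.dupNamespace false

noncomputable section

namespace Summit.PneNP.PneNP.Theorems.HamCompilesKC

open Literature.Computability.Complexity
open Computability CodeFP CanonCode Brick

namespace ResNP

/-! ### Untyped certificates and their code -/

/-- Untyped certificates `(m, d, PA, s₀)`: the size `m`, the margin vector `d` as a list of
numbers, the labelled A-paths `PA` as a list of `(vertex list, label₁, label₂)`, and the row
coordinate `S₀` as a binary number `s₀ < 2^g`. -/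
abbrev Cert : Type := ℕ × List ℕ × List (List ℕ × ℕ × ℕ) × ℕ

/-- The tree encoding of a labelled path `(vertices, label₁, label₂)`. -/
def itemEnc : Encoding (List ℕ × ℕ × ℕ) Bool :=
  encodingNatBool.listBool.pairBool (encodingNatBool.pairBool encodingNatBool)

/-- The tree encoding of certificates. -/
def certEnc : Encoding Cert Bool :=
  encodingNatBool.pairBool
    (encodingNatBool.listBool.pairBool (itemEnc.listBool.pairBool encodingNatBool))

/-- The code of a labelled path, in the combinator format of `CodeFP.lean`. -/
def itemE : List ℕ × ℕ × ℕ → List Bool := pairE (listE natE) (pairE natE natE)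

/-- The code of a certificate, in the combinator format of `CodeFP.lean`. -/
def certE : Cert → List Bool := pairE natE (pairE (listE natE) (pairE (listE itemE) natE))

/-- `itemEnc` codes by `itemE`. -/
theorem itemEnc_encode : (itemEnc.encode : List ℕ × ℕ × ℕ → List Bool) = itemE := by
  rw [itemEnc, pairE_eq, pairE_eq, listE_eq, natE_eq]; rfl

/-- `certEnc` codes by `certE`. -/
theorem certEnc_encode : (certEnc.encode : Cert → List Bool) = certE := by
  rw [certEnc, pairE_eq, pairE_eq, pairE_eq, listE_eq, listE_eq, natE_eq, itemEnc_encode]; rfl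

/-- `certE` is injective. -/
theorem certE_injective : Function.Injective certE := by
  rw [← certEnc_encode]; exact certEnc.encode_injective

/-! ### The total decoder -/

/-- The list of numbers read off any string. -/
def decNatL (w : List Bool) : List ℕ :=
  NegCNF.decList decodeNat (boolUnpair w).1.length (boolUnpair w).2

/-- The labelled path read off any string. -/
def decItem (w : List Bool) : List ℕ × ℕ × ℕ :=
  (decNatL (boolUnpair w).1, decodeNat (boolUnpair (boolUnpair w).2).1,
    decodeNat (boolUnpair (boolUnpair w).2).2)

/-- The list of labelled paths read off any string. -/
def decItems (w : List Bool) : List (List ℕ × ℕ × ℕ) :=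
  NegCNF.decList decItem (boolUnpair w).1.length (boolUnpair w).2

/-- **The certificate read off any string** (the total form of `certEnc.decode`). -/
def decCert (w : List Bool) : Cert :=
  (decodeNat (boolUnpair w).1, decNatL (boolUnpair (boolUnpair w).2).1,
    decItems (boolUnpair (boolUnpair (boolUnpair w).2).2).1,
    decodeNat (boolUnpair (boolUnpair (boolUnpair w).2).2).2)

/-- Canonicalisation of lists of numerals. -/
def canonNatL : List Bool → List Bool := canonListFn canonF

/-- Canonicalisation of labelled paths. -/
def canonPathQ : List Bool → List Bool := canonPairFn canonNatL (canonPairFn canonF canonF)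

/-- Canonicalisation of lists of labelled paths (clip constant `17 ≥ 6 + 11`). -/
def canonPathQs : List Bool → List Bool := canonListFnC 17 canonPathQ

/-- **Canonicalisation of certificate codes.** -/
def canonCert : List Bool → List Bool :=
  canonPairFn canonF (canonPairFn canonNatL (canonPairFn canonPathQs canonF))

/-- `canonF` re-encodes numerals. -/
theorem canonF_eq' (u : List Bool) : canonF u = encodingNatBool.encode (decodeNat u) :=
  canonF_eq_encodeNat_decodeNat u

/-- `canonNatL` re-encodes lists of numerals (and the list decoder is total). -/
theorem canonNatL_eq (w : List Bool) :
    encodingNatBool.listBool.decode w = some (decNatL w) ∧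
      canonNatL w = encodingNatBool.listBool.encode (decNatL w) :=
  canonListFn_eq encodingNatBool decodeNat (fun _ => rfl) canonF_eq' w

/-- `canonPathQ` re-encodes labelled paths (and the decoder is total). -/
theorem canonPathQ_eq (w : List Bool) :
    itemEnc.decode w = some (decItem w) ∧ canonPathQ w = itemEnc.encode (decItem w) := by
  have hp := fun w => canonPairFn_eq encodingNatBool encodingNatBool decodeNat decodeNat (fun _ => rfl)
    (fun _ => rfl) canonF_eq' canonF_eq' w
  exact canonPairFn_eq _ _ decNatL _ (fun u => (canonNatL_eq u).1) (fun u => (hp u).1)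
    (fun u => (canonNatL_eq u).2) (fun u => (hp u).2) w

/-- `|canonNatL w| ≤ 4 |w| + 2`. -/
theorem length_canonNatL_le (w : List Bool) : (canonNatL w).length ≤ 4 * w.length + 2 := by
  rw [canonNatL, canonListFn_apply]
  exact length_listCanon_le (A := 1) (fun u => by simpa only [one_mul] using length_canonF_le u) w

/-- `|canonPathQ w| ≤ 6 |w| + 11`. -/
theorem length_canonPathQ_le (w : List Bool) : (canonPathQ w).length ≤ 6 * w.length + 11 :=
  have h1 : ∀ u, (canonF u).length ≤ 1 * u.length + 1 := fun u => by simpa only [one_mul] using length_canonF_le u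
  length_canonPairFn_le_linear length_canonNatL_le (length_canonPairFn_le_linear h1 h1) w

/-- `canonPathQs` re-encodes lists of labelled paths (and the decoder is total). -/
theorem canonPathQs_eq (w : List Bool) :
    itemEnc.listBool.decode w = some (decItems w) ∧
      canonPathQs w = itemEnc.listBool.encode (decItems w) :=
  canonListFnC_eq itemEnc decItem (fun u => (canonPathQ_eq u).1) (fun u => (canonPathQ_eq u).2)
    length_canonPathQ_le (by norm_num) w

/-- **`canonCert` re-encodes certificates**: `certEnc.decode` is total with value `decCert`, and
`canonCert = encode ∘ decCert`. -/
theorem canonCert_eq (w : List Bool) :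
    certEnc.decode w = some (decCert w) ∧ canonCert w = certEnc.encode (decCert w) := by
  have h3 := fun w => canonPairFn_eq _ encodingNatBool decItems decodeNat
    (fun u => (canonPathQs_eq u).1) (fun _ => rfl) (fun u => (canonPathQs_eq u).2) canonF_eq' w
  have h2 := fun w => canonPairFn_eq _ _ decNatL _ (fun u => (canonNatL_eq u).1) (fun u => (h3 u).1)
    (fun u => (canonNatL_eq u).2) (fun u => (h3 u).2) w
  exact canonPairFn_eq encodingNatBool _ decodeNat _ (fun _ => rfl) (fun u => (h2 u).1) canonF_eq'
    (fun u => (h2 u).2) w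

/-- `canonNatL ∈ FP`. -/
theorem canonNatL_mem_FP : canonNatL ∈ FP := canonListFn_mem_FP canonF_mem_FP (a := 1) length_canonF_le

/-- `canonPathQ ∈ FP`. -/
theorem canonPathQ_mem_FP : canonPathQ ∈ FP :=
  canonPairFn_mem_FP canonNatL_mem_FP (canonPairFn_mem_FP canonF_mem_FP canonF_mem_FP)

/-- **`canonCert ∈ FP`.** -/
theorem canonCert_mem_FP : canonCert ∈ FP :=
  canonPairFn_mem_FP canonF_mem_FP (canonPairFn_mem_FP canonNatL_mem_FP
    (canonPairFn_mem_FP (canonListFnC_mem_FP 17 canonPathQ_mem_FP) canonF_mem_FP))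

/-- **The certificate read off a string is computed on codes in polynomial time.** -/
theorem decCert_codeFP : CodeFP strE certE decCert :=
  of_fn canonCert canonCert_mem_FP fun w => by
    change canonCert w = _
    rw [(canonCert_eq w).2, certEnc_encode]

/-- The decoder inverts the code. -/
theorem decCert_certE (c : Cert) : decCert (certE c) = c := by
  have h := (canonCert_eq (certE c)).1
  rw [← certEnc_encode] at h ⊢
  rw [certEnc.decode_encode] at h
  exact (Option.some.inj h).symm

/-! ### From a polynomial-time test on certificates to `NP` -/

/-- **`NP` membership by certificates.** If a Boolean test `check (s, c)` on strings and
certificates is computed on codes in polynomial time, is sound for `L`, and every member of `L`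
has a passing certificate of polynomially bounded code length, then `L ∈ NP` (`= polyExists P`): the
`P`-language is `{⟨s, y⟩ | check (s, decCert y)}`. -/
theorem mem_NP_of_check {L : Language Bool} {check : List Bool × Cert → Bool}
    (hc : CodeFP (pairE strE certE) bitE check) (p : Polynomial ℕ)
    (hsound : ∀ s c, check (s, c) = true → s ∈ L)
    (hcomplete : ∀ s ∈ L, ∃ c, (certE c).length ≤ p.eval s.length ∧ check (s, c) = true) :
    L ∈ Nondeterministic.NP := by
  have hg : CodeFP (pairE strE strE) bitE (fun q : List Bool × List Bool => check (q.1, decCert q.2)) :=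
    hc.comp ((fst _ _).pair (decCert_codeFP.comp (snd _ _)))
  obtain ⟨f, hf, hfg⟩ := hg
  have hval : ∀ s y : List Bool,
      (HashBricks.headBitFn ∘ f) (boolPair s y) = [check (s, decCert y)] := fun s y => by
    have e := hfg (s, y)
    simp only [pairE_apply] at e
    change HashBricks.headBitFn (f (boolPair (strE s) (strE y))) = _
    rw [e, HashBricks.headBitFn_apply]
    simp [bitE]
  refine ⟨{w | (HashBricks.headBitFn ∘ f) w = [true]}, ?_, p, fun s => ⟨fun hs => ?_, ?_⟩⟩
  · refine mem_P_of_mem_FP (comp_mem_FP HashBricks.headBitFn_mem_FP hf) _ fun w => ⟨fun h => h, fun h => ?_⟩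
    have h1 : (HashBricks.headBitFn ∘ f) w = [(f w).headD false] := HashBricks.headBitFn_apply _
    have h' : ¬ (HashBricks.headBitFn ∘ f) w = [true] := h
    rw [h1] at h' ⊢
    cases hb : (f w).headD false
    · rfl
    · exact absurd (by rw [hb]) h'
  · obtain ⟨c, hlen, hck⟩ := hcomplete s hs
    refine ⟨certE c, hlen, ?_⟩
    show (HashBricks.headBitFn ∘ f) (boolPair s (certE c)) = [true]
    rw [hval, decCert_certE, hck]
  · rintro ⟨y, -, hy⟩
    have hy' : (HashBricks.headBitFn ∘ f) (boolPair s y) = [true] := hy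
    rw [hval] at hy'
    exact hsound s (decCert y) (by simpa using hy')

/-! ### Reading the interface string -/

/-- Bit `j` of the string (`false` past its end). -/
def bit (s : List Bool) (j : ℕ) : Bool := s.getD j false

/-- The A-block bit `ab (inl (u, v))`: position `v + m u`. -/
def abit (s : List Bool) (m u v : ℕ) : Bool := bit s (v + m * u)

/-- The class-table bit `ab (inr (i, a))`: position `m² + (a + m i)`. -/
def nbit (s : List Bool) (m i a : ℕ) : Bool := bit s (m * m + (a + m * i))

/-- The F-block bit `fb (w, S₀, S)` at the numbers `c, s₀, n` of `w, S₀, S`: position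
`(m² + g m) + ((n + 2^g s₀) + (2^g 2^g) c)`. -/
def fbit (s : List Bool) (m g c s0 n : ℕ) : Bool :=
  bit s ((m * m + g * m) + ((n + 2 ^ g * s0) + (2 ^ g * 2 ^ g) * c))

/-- The length `ell m` of an interface string, from `m` and `g = ⌊log₂ m⌋`. -/
def ellN (m g : ℕ) : ℕ := (m * m + g * m) + 2 ^ (3 * g) * (2 ^ g * 2 ^ g)

/-! ### The tests -/

/-- Header: `4 ≤ m` and `|s| = ell m`. -/
def hdrOK (s : List Bool) (m g : ℕ) : Bool := decide (4 ≤ m) && decide (s.length = ellN m g)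

/-- Margins: `g` numbers of sum `≤ 2g`. -/
def dOK (g : ℕ) (dL : List ℕ) : Bool := decide (dL.length = g) && decide (dL.sum ≤ 2 * g)

/-- Shape of a labelled path: nonempty, vertices `< m`, labels `< g`. -/
def itemOK (m g : ℕ) (q : List ℕ × ℕ × ℕ) : Bool :=
  !q.1.isEmpty && q.1.all (fun v => decide (v < m)) && decide (q.2.1 < g) && decide (q.2.2 < g)

/-- Shape of the labelled path family. -/
def shapeOK (m g : ℕ) (PAL : List (List ℕ × ℕ × ℕ)) : Bool := PAL.all (itemOK m g)

/-- All listed vertices. -/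
def verts (PAL : List (List ℕ × ℕ × ℕ)) : List ℕ := (PAL.map Prod.fst).flatten

/-- Cover: the listed vertices are distinct and are exactly the anchored ones `{v | v + g < m}`
(the loop bound `m - g` is capped by `cap = |s|`, inactive when `m ≤ |s|`). -/
def coverOK (m g cap : ℕ) (PAL : List (List ℕ × ℕ × ℕ)) : Bool :=
  decide (verts PAL).Nodup && (verts PAL).all (fun v => decide (v + g < m)) &&
    (List.range (min (m - g) cap)).all (fun v => decide (v ∈ verts PAL))

/-- Adjacency in the symmetrised loopless graph of the A-block. -/
def adjB (s : List Bool) (m u v : ℕ) : Bool := !decide (u = v) && (abit s m u v || abit s m v u)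

/-- Consecutive items are related. -/
def chainB (R : ℕ → ℕ → Bool) (l : List ℕ) : Bool := (List.zipWith R l l.tail).all fun b => b

/-- Every listed path is a path of the A-block graph. -/
def chainsOK (s : List Bool) (m : ℕ) (PAL : List (List ℕ × ℕ × ℕ)) : Bool :=
  PAL.all fun q => chainB (adjB s m) q.1

/-- The last item of a list of numbers (`0` for `[]`). -/
def lastD (l : List ℕ) : ℕ := l.getD (l.length - 1) 0

/-- Label validity: `N(label₁, first vertex)` and `N(label₂, last vertex)`. -/
def labelsOK (s : List Bool) (m : ℕ) (PAL : List (List ℕ × ℕ × ℕ)) : Bool :=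
  PAL.all fun q => nbit s m q.2.1 (q.1.headD 0) && nbit s m q.2.2 (lastD q.1)

/-- A-slots: label `i` is used `d i` times. -/
def slotsOK (g : ℕ) (dL : List ℕ) (PAL : List (List ℕ × ℕ × ℕ)) : Bool :=
  (List.range g).all fun i =>
    decide ((PAL.map fun q => q.2.1).count i + (PAL.map fun q => q.2.2).count i = dL.getD i 0)

/-- Prefix sums `d₀ + ⋯ + dᵢ` (for `i < g`; the loop bound is capped by `g`). -/
def psum (g : ℕ) (dL : List ℕ) (i : ℕ) : ℕ := ((List.range (min (i + 1) g)).map fun t => dL.getD t 0).sum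

/-- Bit `j` of the stars-and-bars code word of `d`: `j = i + d₀ + ⋯ + dᵢ` for some `i < g`. -/
def sbTest (g : ℕ) (dL : List ℕ) (j : ℕ) : Bool :=
  (List.range g).any fun i => decide (j = i + psum g dL i)

/-- The stars-and-bars code word of `d` as a binary number below `2^{3g}` (the exponent `j < 3g`
is capped by `3g`). -/
def sbNum (g : ℕ) (dL : List ℕ) : ℕ :=
  ((List.range (3 * g)).map fun j => if sbTest g dL j then 2 ^ min j (3 * g) else 0).sum

/-- The `g` low binary digits of `n` (the exponent `i < g` is capped by `g`). -/
def bitsLE (g n : ℕ) : List ℕ := (List.range g).map fun i => n / 2 ^ min i g % 2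

/-- The anchor of `d`: its least positive position (`|d|` if none). -/
def anchor (dL : List ℕ) : ℕ := dL.findIdx fun x => decide (0 < x)

/-- Admissibility of the cut `S` of number `n`: inside the support of `d`, contains the anchor. -/
def admB (g : ℕ) (dL : List ℕ) (n : ℕ) : Bool :=
  ((List.range g).all fun i => !decide ((bitsLE g n).getD i 0 = 1) || decide (0 < dL.getD i 0)) &&
    (decide (anchor dL < g) && decide ((bitsLE g n).getD (anchor dL) 0 = 1))

/-- Consistency of the cut `S` of number `n` with the A-edges. -/
def consB (g : ℕ) (PAL : List (List ℕ × ℕ × ℕ)) (n : ℕ) : Bool :=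
  PAL.all fun q => decide ((bitsLE g n).getD q.2.1 0 = 1) == decide ((bitsLE g n).getD q.2.2 0 = 1)

/-- The cuts counted by the parity test. -/
def goodCut (s : List Bool) (m g : ℕ) (dL : List ℕ) (PAL : List (List ℕ × ℕ × ℕ)) (s0 n : ℕ) : Bool :=
  fbit s m g (sbNum g dL) s0 n && (admB g dL n && consB g PAL n)

/-- Parity: an odd number of admissible consistent cuts `S < 2^g` have a `1` in row `s₀` of the
F-block at the code word of `d` (the loop bound `2^g` is capped by `cap = |s|`). -/
def parityOK (s : List Bool) (m g cap : ℕ) (dL : List ℕ) (PAL : List (List ℕ × ℕ × ℕ)) (s0 : ℕ) :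
    Bool :=
  decide (((List.range (min (2 ^ g) cap)).filter (goodCut s m g dL PAL s0)).length % 2 = 1)

/-- **All tests**, for a given `g`. -/
def check₁ (s : List Bool) (m g : ℕ) (dL : List ℕ) (PAL : List (List ℕ × ℕ × ℕ)) (s0 : ℕ) : Bool :=
  hdrOK s m g && dOK g dL && shapeOK m g PAL && coverOK m g s.length PAL && chainsOK s m PAL &&
    labelsOK s m PAL && slotsOK g dL PAL && decide (s0 < 2 ^ g) && parityOK s m g s.length dL PAL s0

/-- **The verifier**: `m ≤ |s|`, then all tests at `g = ⌊log₂ m⌋` (capped by `|s|`). -/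
def check (p : List Bool × Cert) : Bool :=
  decide (p.2.1 ≤ p.1.length) &&
    check₁ p.1 p.2.1 (min p.1.length (Nat.log 2 p.2.1)) p.2.2.1 p.2.2.2.1 p.2.2.2.2

end ResNP

/-- Registered sub-goal of `stub_residueNP` served by this file: the certificate decoder inverts the
certificate code. -/
theorem stub_residueNP_decode : ∀ c : ResNP.Cert, ResNP.decCert (ResNP.certE c) = c :=
  ResNP.decCert_certE


end Summit.PneNP.PneNP.Theorems.HamCompilesKC
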